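import Literature.Geometry.Riemannian.ConstantCurvatureRicci
import Literature.Geometry.Riemannian.HyperbolicBallCompactification
import Literature.Geometry.Riemannian.RoundSphere
import Literature.Geometry.Riemannian.RiemannianDistance
import Literature.Geometry.Lorentzian.Hypersurface
import Literature.Geometry.Lorentzian.IsometryProofs
import Literature.Topology.FourManifolds.ClosedBallTangent
import Literature.Topology.FourManifolds.ClosedBallSmoothEmbeddings
import Literature.Topology.FourManifolds.InteriorSmoothEmbedding
import Literature.Topology.FourManifolds.ImmersionCriterion
import Literature.Geometry.Manifold.OpenSubmanifoldMFDeriv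

/-!
# Crux `PEFillNearRound` (stmt-SmoothPoincare4-7997), line `Sketch`, helper piece `helper_rf_compactifiedMetric` of
# `helper_roundFilled` (the round `S⁴` bounds hyperbolic `5`-space = route item
# `EinsteinBulk.RoundSphereBoundsHyperbolicSpace`, the base point of `stub_peFillStandard`)

The compactified metric `ḡ = |dx|²` on the closed ball `𝔻⁵`, as a `C²` Mathlib bundle metric on the manifold with boundary: the metric induced from the Euclidean metric of `ℝ⁵` by the inclusion `𝔻⁵ ↪ ℝ⁵` (an immersion, differential `closedBallCoeDeriv`).
-/

noncomputable section

-- the prescribed namespace `Summit.<P>.<Sub>.…` duplicates `SmoothPoincare4` (P = Sub)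
set_option linter.dupNamespace false

open scoped Manifold ContDiff Topology RealInnerProductSpace
open Set Function Metric Bundle TopologicalSpace
open Literature.Geometry.Lorentzian Literature.Geometry.Lorentzian.PseudoRiemannianMetric
open Literature.Geometry.Riemannian Literature.Topology.FourManifolds
open Literature.Geometry.Manifold

namespace Summit.SmoothPoincare4.SmoothPoincare4.Cruxes.PEFillNearRound.RoundFilled

/-- **The Euclidean metric of the closed `5`-ball as a `C²` bundle metric**, characterised by `ḡ_p(a,b) = ⟪dι_p a, dι_p b⟫` with `dι_p = closedBallCoeDeriv p` (O'Neill 1983, Ch. 4, p. 97, induced metric of an immersion). -/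
theorem helper_rf_compactifiedMetric :
    ∃ gb : Bundle.ContMDiffRiemannianMetric (𝓡∂ 5) 2 (EuclideanSpace ℝ (Fin 5)) (TangentSpace (𝓡∂ 5) : ↥(Metric.closedBall (0 : EuclideanSpace ℝ (Fin 5)) 1) → Type _), ∀ (p : ↥(Metric.closedBall (0 : EuclideanSpace ℝ (Fin 5)) 1)) (a b : TangentSpace (𝓡∂ 5) p), gb.inner p a b = inner ℝ (Literature.Topology.FourManifolds.closedBallCoeDeriv p a) (Literature.Topology.FourManifolds.closedBallCoeDeriv p b) := by
  -- regularity bookkeeping: `2 ≤ ∞` and `2 + 1 ≤ ∞` in `ℕ∞ω`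
  have h2 : (2 : ℕ∞ω) ≤ ∞ := WithTop.coe_le_coe.mpr le_top
  have h3 : (2 + 1 : ℕ∞ω) ≤ ∞ := WithTop.coe_le_coe.mpr le_top
  -- the differential of the inclusion `𝔻⁵ ↪ ℝ⁵`, pointwise, is `closedBallCoeDeriv`
  have hpt : ∀ (p : ↥(Metric.closedBall (0 : EuclideanSpace ℝ (Fin 5)) 1))
      (v : TangentSpace (𝓡∂ 5) p),
      mfderiv (𝓡∂ 5) 𝓘(ℝ, EuclideanSpace ℝ (Fin 5))
        (Subtype.val : ↥(Metric.closedBall (0 : EuclideanSpace ℝ (Fin 5)) 1) →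
          EuclideanSpace ℝ (Fin 5)) p v = closedBallCoeDeriv p v := fun p v => by
    rw [mfderiv_coe_closedBall]
    rfl
  -- the inclusion is a spacelike immersion for the (`C²`-lowered) Euclidean metric of `ℝ⁵`
  have hsp : ((euclideanMetric (EuclideanSpace ℝ (Fin 5))).ofLE h2).IsSpacelikeImmersion (𝓡∂ 5)
      (Subtype.val : ↥(Metric.closedBall (0 : EuclideanSpace ℝ (Fin 5)) 1) →
        EuclideanSpace ℝ (Fin 5)) := by
    refine ⟨contMDiff_coe_closedBall.of_le h3, fun y v hv => ?_⟩
    rw [inducedBilin_apply, val_ofLE, euclideanMetric_apply, hpt y v]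
    have hne : closedBallCoeDeriv y v ≠ 0 := fun h => hv (EmbeddingLike.map_eq_zero_iff.1 h)
    exact real_inner_self_pos.mpr hne
  refine ⟨((euclideanMetric (EuclideanSpace ℝ (Fin 5))).ofLE h2).inducedRiemannianMetric
    (Subtype.val : ↥(Metric.closedBall (0 : EuclideanSpace ℝ (Fin 5)) 1) →
      EuclideanSpace ℝ (Fin 5)) contMDiff_pullbackBilin_holds hsp, fun p a b => ?_⟩
  rw [inducedRiemannianMetric_inner, inducedBilin_apply, val_ofLE, euclideanMetric_apply, hpt p a,
    hpt p b]
  rfl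

end Summit.SmoothPoincare4.SmoothPoincare4.Cruxes.PEFillNearRound.RoundFilled

end
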